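import Summits.Ventures.HSemireg.Pad4TowerSeedB1OddLemmas

/-!
# Venture HSemireg — PAD-4 on 𝔅(μ₄): LEMMA C and LEMMA L UNIFORM IN THE HEIGHT h (gs-eng-2 g53)

HONEST FRAMING. Lean index of the computation cell `pub-hsemireg` (S4-PUSH, H2 door PAD-4, line stmt-HodgeConjecture-18881), written by the
cell's second-code engine `gs-eng-2` (g53); sequel of `Pad4TowerSeedB1OddLemmas` (994). Census-neutral: lemmas ABOUT THE TYPED STATIC
PREDICATES `XPlusClosed` ∕ `RuleDMu4P` ∕ `InDiamond`; nothing here is an object, a σ, a seed or a census row; NOTHING HERE SAYS THAT HC ∕ HC_CM ∕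
HC_AV ∕ H2 HOLDS OR FAILS. No `sorry`, no `axiom`, no `instance`, no notation, no Literature fact.

WHAT. `Pad4TowerSeedB1OddLemmas` proves the X⁺ ceiling kill (LEMMA C) and the forced lift (LEMMA L) at height `8` (`cu8 = 6I+ℓ_u`, `top8 = 8I`).
The proofs use only «every ◇_h letter is causally below the top node hI and none is strictly null-above it» (`effective_top_sub`,
`inDiamond_le_top`, `not_nullBelow_top`, all stated for general `h` there), so both lemmas hold VERBATIM in every ◇_h with the ceiling unit
letter `(h−2)I + ℓ_u` and the top node `hI`. This file states and proves them in that form — motif (M2) of the peel, uniform in `h`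
(director-hodge R14.31 (2): the uniform-in-h rows the lens ideators are pointed at; companion of `Pad4TowerSeedB1OddFloor`'s uniform (M1)):
**`xplus_ceiling_kill_h`**, **`lift_of_ceiling_unit_h`**, and the corollary **`not_mem_apex_apex_cu_top_h`** (RULE D + Δ² + X⁺: no
`P[x|y|(h−2)I+ℓ_u|hI]` with apex `x, y` on an `H₁`-static `G₁`-closed ◇_h support, any `h`).

SOURCES: `Pad4TowerSeedB1OddLemmas.lean` (994; LEMMA C∕L at h = 8 and the ◇_h bounds), `Pad4TowerXresFamilies.lean`, `Pad4TowerRuleDMu4Dual.lean`,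
`Pad4TowerDiamondMu4.lean`; note `general-structure∕PENCIL-B1ODD-gs2g53.md` v0.4 §5e∕§5g. -/

namespace Summit.Ventures.HSemireg.Pad4Tower

open Finset

/-- the ceiling unit letter `(h−2)·I + ℓ_{i^u}` of ◇_h. -/
abbrev cuH (h : ℤ) (u : Fin 4) : BPoint := ray (h - 2, 0, 0) u 1

/-- the top node `h·I` of ◇_h. -/
abbrev topH (h : ℤ) : BPoint := (h, 0, 0)

/-- **LEMMA C, uniform in h — THE X⁺ CEILING KILL in ◇_h.** A `P`-cell `Z` of an `X⁺`-closed configuration inside ◇_h with the ceiling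
unit letter `(h−2)I+ℓ_u` on `σ` and the top node `hI` on `f ≠ σ`, whose lift `Z(σ ↦ hI)` is an `N`-cell and one of whose `σ`-variants
`Z(σ ↦ (h−2)I+ℓ_v)`, `v ≠ u`, is a `P`-cell, is contradictory. [as `xplus_ceiling_kill`, with `8 ↦ h`] -/
theorem xplus_ceiling_kill_h {C : MConfig} {h : ℤ} (hU : C.InDiamond h) (hX : XPlusClosed C) {Z : MCell} (hZ : Z ∈ C.upper)
    {σ f : Fin 4} (hfσ : f ≠ σ) {u v : Fin 4} (hvu : v ≠ u) (hZσ : Z σ = cuH h u) (hZf : Z f = topH h)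
    (hq : Function.update Z σ (topH h) ∈ C.lower) (hn : Function.update Z σ (cuH h v) ∈ C.upper) : False := by
  set Z' : MCell := dualCell 0 Z with hZ'
  set q' : MCell := dualCell 0 (Function.update Z σ (topH h)) with hq'
  set n' : MCell := dualCell 0 (Function.update Z σ (cuH h v)) with hn'
  have hZ'mem : Z' ∈ (C.dual 0).lower := dualCell_mem_dual_lower hZ
  have hq'mem : q' ∈ (C.dual 0).upper := dualCell_mem_dual_upper hq
  have hn'mem : n' ∈ (C.dual 0).lower := dualCell_mem_dual_lower hn
  have eZσ : Z' σ = dualPt 0 (cuH h u) := by simp [hZ', dualCell, hZσ]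
  have eZf : Z' f = (-h, 0, 0) := by simp [hZ', dualCell, hZf, topH, dualPt]
  have eqσ : q' σ = (-h, 0, 0) := by simp [hq', dualCell, topH, dualPt]
  have enσ : n' σ = dualPt 0 (cuH h v) := by simp [hn', dualCell]
  have eqg : ∀ g, g ≠ σ → q' g = Z' g := fun g hg => by simp [hq', hZ', dualCell, Function.update_of_ne hg]
  have eng : ∀ g, g ≠ σ → n' g = q' g := fun g hg => by simp [hn', hq', dualCell, Function.update_of_ne hg]
  have key : ∀ x : BPoint, InDiamond h x →
      Effective (bsub (dualPt 0 x) (-h, 0, 0)) ∧ -h ≤ (dualPt 0 x).1 ∧ ¬ NullBelow (dualPt 0 x) (-h, 0, 0) := by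
    intro x hx
    refine ⟨?_, ?_, not_nullBelow_top hx⟩
    · have e : bsub (dualPt 0 x) (-h, 0, 0) = bsub (h, 0, 0) x := by
        obtain ⟨a, b, c⟩ := x
        simp only [bsub, Prod.mk.injEq]
        refine ⟨by ring, by ring, by ring⟩
      rw [e]; exact effective_top_sub hx
    · have := inDiamond_le_top hx
      obtain ⟨a, b, c⟩ := x
      simp only at this ⊢
      omega
  have bound : ∀ P ∈ (C.dual 0).upper, ∀ g,
      Effective (bsub (P g) (-h, 0, 0)) ∧ -h ≤ (P g).1 ∧ ¬ NullBelow (P g) (-h, 0, 0) := by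
    intro P hP g
    have hN : dualCell 0 P ∈ C.lower := mem_dual_upper.mp hP
    have hx : InDiamond h (dualCell 0 P g) := hU.1 _ hN g
    have e1 : P g = dualPt 0 (dualCell 0 P g) := by simp [dualCell, dualPt_dualPt]
    rw [e1]; exact key _ hx
  apply hX Z' hZ'mem q' hq'mem n' hn'mem σ (u + 2) (v + 2) f
  refine ⟨?_, hfσ, ⟨?_, ?_, ?_⟩, ?_, ?_, ⟨?_, ?_, ?_⟩, ?_, ?_, ?_, ?_⟩
  · rw [eZσ]; fin_cases u <;> simp [isApex]
  · exact fun g hg => eqg g hg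
  · rw [eqσ, eZσ]; fin_cases u <;> simp
  · rw [eqσ, eZσ]; fin_cases u <;> simp [ray, dualPt] <;> ring_nf
  · intro P hP hPZ
    obtain ⟨-, hlt, -⟩ := hPZ
    have hb := (bound P hP σ).2.1
    rw [eqσ]; rw [eZσ] at hlt
    revert hlt hb
    fin_cases u <;> simp <;> intro h1 h2 <;> omega
  · revert hvu; fin_cases u <;> fin_cases v <;> decide
  · exact fun g hg => eng g hg
  · rw [eqσ, enσ]; fin_cases v <;> simp
  · rw [eqσ, enσ]; fin_cases v <;> simp [ray, dualPt] <;> ring_nf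
  · intro P hP _ h1 h2
    rw [eqσ] at h1; rw [enσ] at h2
    revert h1 h2; fin_cases v <;> simp [ray] <;> intro h1 h2 <;> omega
  · intro P hP _ _ _ _
    rw [eqσ]; exact (bound P hP σ).1
  · intro P hP _ hnb _
    rw [eZf] at hnb
    exact absurd hnb (bound P hP f).2.2
  · intro P hP hnb
    rw [eZf] at hnb
    exact absurd hnb (bound P hP f).2.2

/-- **LEMMA L, uniform in h — the `hI`-lift is forced.** [as `lift_of_ceiling_unit`, with `8 ↦ h`] -/
theorem lift_of_ceiling_unit_h {C : MConfig} {h : ℤ} (hU : C.InDiamond h) {Z : MCell} (hD : RuleDMu4P C Z)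
    {σ f : Fin 4} (hfσ : f ≠ σ) {u : Fin 4} (hZσ : Z σ = cuH h u) (hZf : Z f = topH h) :
    Function.update Z σ (topH h) ∈ C.lower := by
  have had1 : Adapted (Z σ) (u + 2) := by rw [hZσ]; fin_cases u <;> simp [Adapted]
  have had2 : Adapted (Z f) 0 := by rw [hZf]; simp [Adapted]
  have hne : coord (Z σ) (u + 2) ≠ coord (Z f) 0 := by
    rw [hZσ, hZf]; fin_cases u <;> simp [coord]
  have noabove : ∀ N ∈ C.lower, ¬ (Z f).1 < (N f).1 := fun N hN hlt => by
    have := inDiamond_le_top (hU.1 N hN f); rw [hZf] at hlt; simp at hlt; omega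
  rcases hD σ f (Ne.symm hfσ) (u + 2) 0 had1 had2 hne with ⟨r, hr, N, hN, hag, hlt, hray⟩ | ⟨r, -, N, hN, -, hlt, -⟩ |
      ⟨a, b, -, -, N, hN, -, -, -, hlt, -⟩
  · have h8 : N σ = topH h := by
      have hle := inDiamond_le_top (hU.1 N hN σ)
      rw [hZσ] at hlt
      have : (N σ).1 = h := by revert hlt hle; fin_cases u <;> simp <;> intro h1 h2 <;> omega
      exact eq_top_of_inDiamond (hU.1 N hN σ) this
    have hNe : N = Function.update Z σ (topH h) := by
      funext g
      by_cases hg : g = σ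
      · subst hg; simp [h8]
      · rw [Function.update_of_ne hg]; exact (hag g hg).symm
    rw [← hNe]; exact hN
  · exact absurd hlt (noabove N hN)
  · exact absurd hlt (noabove N hN)

/-- **COROLLARY, uniform in h**: on a `G₁`-closed `H₁`-static support inside ◇_h, no `P`-cell `[x | y | (h−2)I+ℓ_u | hI]` with apex `x, y`
is present (RULE D forces the lift; Δ² supplies the variant; X⁺ fires). -/
theorem not_mem_apex_apex_cu_top_h {C : MConfig} {h : ℤ} (hU : C.InDiamond h) (hG : C.G1Closed) (hS : C.StaticH1)
    {x y : BPoint} (hx : isApex x) (hy : isApex y) (u : Fin 4) : mcellOf x y (cuH h u) (topH h) ∉ C.upper := by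
  intro hZ
  set Z : MCell := mcellOf x y (cuH h u) (topH h) with hZdef
  have hZ2 : Z 2 = cuH h u := by simp [hZdef, mcellOf]
  have hZ3 : Z 3 = topH h := by simp [hZdef, mcellOf]
  have hq : Function.update Z 2 (topH h) ∈ C.lower := lift_of_ceiling_unit_h hU (hS.1.2 Z hZ) (by decide) hZ2 hZ3
  have hn0 : Z.delta.delta ∈ C.upper := hG.2.2.2 _ (hG.2.2.2 _ hZ)
  have hdd : ∀ z : BPoint, isApex z → deltaPt (deltaPt z) = z := by
    rintro ⟨a, b, c⟩ ⟨hb, hc⟩; simp only at hb hc; subst hb; subst hc; simp [deltaPt]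
  have hn : Z.delta.delta = Function.update Z 2 (cuH h (u + 2)) := by
    funext g
    fin_cases g
    · simp [MCell.delta, hZdef, mcellOf, hdd x hx]
    · simp [MCell.delta, hZdef, mcellOf, hdd y hy]
    · simp [MCell.delta, hZdef, mcellOf]; fin_cases u <;> simp [deltaPt]
    · simp [MCell.delta, hZdef, mcellOf, topH, deltaPt]
  rw [hn] at hn0
  exact xplus_ceiling_kill_h hU hS.2.1 hZ (σ := 2) (f := 3) (by decide) (v := u + 2) (by fin_cases u <;> decide) hZ2 hZ3 hq hn0

end Summit.Ventures.HSemireg.Pad4Tower
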